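import Summits.KontsevichZagierPeriods.KontsevichZagierPeriods.Theorems.SoloInformedKZStokesSimplexFaces
import HarnessLib

/-!
# SoloInformed — KZ–Stokes in every dimension

**Theorem (KZ–Stokes on the simplex, all `m`).**  Let `Δ = Δᵐ⁺¹ ⊆ ℝᵐ⁺¹` be the standard simplex
`{z | 0 ≤ zⱼ, Σ zⱼ ≤ 1}`, `W ⊇ Δ` open, and `g₀, …, g_m : W → ℝ` functions that are `C¹` on `W` and
semialgebraic over `ℚ` on `W`.  Put `ω = Σᵢ (−1)ⁱ gᵢ dz₀ ∧ … ∧ \widehat{dzᵢ} ∧ … ∧ dz_m`, so that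
`dω = (Σᵢ (−1)ⁱ ∂ᵢ gᵢ) dz`.  Then, in the free abelian group on integral representations, the element

  `[Δᵐ⁺¹, Σᵢ (−1)ⁱ ∂ᵢgᵢ] − ( [Δᵐ, Σᵢ (−1)ⁱ gᵢ ∘ ∂⁰] − Σᵢ (−1)ⁱ [Δᵐ, gᵢ ∘ ∂ᶻᵢ] )`

lies in `KZ.relations` — i.e. *Stokes' formula `∫_Δ dω = ∫_{∂Δ} ω` for the simplex is a `ℤ`-combination
of the three Kontsevich–Zagier moves* (additivity of the integrand, change of variables, and the
one-variable Newton–Leibniz formula).  Here `∂⁰ s = (1 − Σ s, s)` parametrises the oblique facet and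
`∂ᶻᵢ s = insertNth i 0 s` the `i`-th coordinate facet, both by `Δᵐ`; see
`soloInformed_kzStokes_simplex`.  The numerical Stokes formula follows by the soundness of the calculus
(`soloInformed_stokes_simplex_value`), and the representations exist (`soloInformed_kzStokes_simplex_exists`).

**Proof.**  For each `i`: (1) relabel coordinates by the permutation `Pᵢ` (a change of variables with
`|det| = 1`, `soloInformed_of_sub_of_affine_mem_relations`) so that `zᵢ` becomes the last coordinate;
(2) `Δᵐ⁺¹` is then the band `0 ≤ t ≤ 1 − Σ s` over `Δᵐ`, and the Newton–Leibniz move integrates `∂ᵢ gᵢ`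
along it, producing `gᵢ` on the top facet `t = 1 − Σ s` minus `gᵢ` on the facet `zᵢ = 0`
(`soloInformed_kzStokes_face`); (3) the top facet parametrisation `s ↦ insertNth i (1 − Σ s) s` differs
from the oblique parametrisation `∂⁰` by the affine automorphism `Aᵢ` of `Δᵐ` (a vertex relabelling),
again a change of variables with `|det| = 1` (`soloInformed_kzStokes_topFace_obliqueFace`); (4) sum over
`i` with signs using finite additivity of the integrand.  This is the engine of THEOREM D (transfer of
Ayoub-type Stokes relations into the KZ calculus) of the solo-informed programme; the case `m = 1` is
`soloInformed_kzStokes_triangle`.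
-/

noncomputable section

open scoped BigOperators
open Set MeasureTheory
open Literature.NumberTheory.Transcendental Literature.NumberTheory.Transcendental.KZ
open Literature.ModelTheory.ExponentialFields (IsSemialgebraic)

namespace Summit.KontsevichZagierPeriods.KontsevichZagierPeriods.Theorems

/-! ### Regularity of the facet parametrisations -/

/-- `x ↦ insertNth i (φ x) x` is continuous for continuous `φ`. -/
theorem soloInformed_continuous_insertNth_apply {m : ℕ} (i : Fin (m + 1)) {φ : (Fin m → ℝ) → ℝ}
    (hφ : Continuous φ) :
    Continuous fun x : Fin m → ℝ => (Fin.insertNth i (φ x) x : Fin (m + 1) → ℝ) :=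
  hφ.finInsertNth i continuous_id

/-- The top facet parametrisation is continuous. -/
theorem soloInformed_continuous_topFace {m : ℕ} (i : Fin (m + 1)) :
    Continuous fun s : Fin m → ℝ => soloInformedTopFace i s :=
  soloInformed_continuous_insertNth_apply i (φ := fun s => 1 - ∑ k, s k)
    (continuous_const.sub (continuous_finsetSum _ fun k _ => continuous_apply k))

/-- The coordinate facet parametrisation is continuous. -/
theorem soloInformed_continuous_coordFace {m : ℕ} (i : Fin (m + 1)) :
    Continuous fun s : Fin m → ℝ => soloInformedCoordFace i s :=
  soloInformed_continuous_insertNth_apply i (φ := fun _ => 0) continuous_const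

/-- The oblique facet parametrisation is continuous. -/
theorem soloInformed_continuous_obliqueFace {m : ℕ} :
    Continuous fun s : Fin m → ℝ => soloInformedObliqueFace s :=
  (soloInformed_continuous_topFace 0).congr fun s => (soloInformedObliqueFace_eq_topFace s).symm

/-- The top facet parametrisation is a semialgebraic map. -/
theorem soloInformed_isSemialgebraicMapOn_topFace {m : ℕ} {s : Set (Fin m → ℝ)}
    (hs : IsSemialgebraic ℚ s) (i : Fin (m + 1)) :
    IsSemialgebraicMapOn ℚ s (fun x => soloInformedTopFace i x) :=
  IsSemialgebraicMapOn.of_forall hs fun j =>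
    soloInformed_isSemialgebraicFunOn_insertNth_apply hs
      (soloInformed_isSemialgebraicFunOn_one_sub_sum hs) i j

/-- The coordinate facet parametrisation is a semialgebraic map. -/
theorem soloInformed_isSemialgebraicMapOn_coordFace {m : ℕ} {s : Set (Fin m → ℝ)}
    (hs : IsSemialgebraic ℚ s) (i : Fin (m + 1)) :
    IsSemialgebraicMapOn ℚ s (fun x => soloInformedCoordFace i x) :=
  IsSemialgebraicMapOn.of_forall hs fun j =>
    soloInformed_isSemialgebraicFunOn_insertNth_apply hs (φ := fun _ => 0)
      (by simpa using isSemialgebraicFunOn_ratCast hs 0) i j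

/-- The oblique facet parametrisation is a semialgebraic map. -/
theorem soloInformed_isSemialgebraicMapOn_obliqueFace {m : ℕ} {s : Set (Fin m → ℝ)}
    (hs : IsSemialgebraic ℚ s) :
    IsSemialgebraicMapOn ℚ s (fun x : Fin m → ℝ => soloInformedObliqueFace x) :=
  (soloInformed_isSemialgebraicMapOn_topFace hs 0).congr fun x _ =>
    (soloInformedObliqueFace_eq_topFace x).symm

/-! ### One coordinate direction -/

/-- **Newton–Leibniz along the `i`-th coordinate of the simplex.**  For `g` semialgebraic and `C¹`
on an open `W ⊇ Δᵐ⁺¹`: `[Δᵐ⁺¹, ∂ᵢ g] − ([Δᵐ, g ∘ τᵢ] − [Δᵐ, g ∘ ∂ᶻᵢ]) ∈ KZ.relations`, where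
`τᵢ s = insertNth i (1 − Σ s) s` is the top facet over the `i`-th direction and
`∂ᶻᵢ s = insertNth i 0 s` the facet `zᵢ = 0`.  Obtained from one change of variables (the
coordinate permutation `Pᵢ`, `|det Pᵢ| = 1` by the volume trick), one Newton–Leibniz move along the
band `0 ≤ t ≤ 1 − Σ s`, and integrand additivity. -/
theorem soloInformed_kzStokes_face {m : ℕ} {W : Set (Fin (m + 1) → ℝ)} (hW : IsOpen W)
    (hΔW : soloInformedSimplex (m + 1) ⊆ W) {g : (Fin (m + 1) → ℝ) → ℝ}
    (hgs : IsSemialgebraicFunOn ℚ W g) (hgd : ContDiffOn ℝ 1 g W) (i : Fin (m + 1))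
    (rD : IntegralRep (m + 1)) (hDd : rD.domain = soloInformedSimplex (m + 1))
    (hDi : EqOn rD.integrand (fun z => fderiv ℝ g z (Pi.single i 1)) (soloInformedSimplex (m + 1)))
    (rT rB : IntegralRep m) (hTd : rT.domain = soloInformedSimplex m)
    (hBd : rB.domain = soloInformedSimplex m)
    (hTi : EqOn rT.integrand (fun s => g (soloInformedTopFace i s)) (soloInformedSimplex m))
    (hBi : EqOn rB.integrand (fun s => g (soloInformedCoordFace i s)) (soloInformedSimplex m)) :
    of rD - (of rT - of rB) ∈ relations := by
  have hΔ := isSemialgebraic_soloInformedSimplex (m + 1)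
  have hΔ' := isSemialgebraic_soloInformedSimplex m
  have hd : ∀ z ∈ W, DifferentiableAt ℝ g z := fun z hz =>
    (hgd.differentiableOn one_ne_zero z hz).differentiableAt (hW.mem_nhds hz)
  have hc : ContinuousOn g W := hgd.continuousOn
  have hgsΔ : IsSemialgebraicFunOn ℚ (soloInformedSimplex (m + 1)) g := hgs.mono hΔW hΔ
  have hDs : IsSemialgebraicFunOn ℚ (soloInformedSimplex (m + 1))
      (fun z => fderiv ℝ g z (Pi.single i 1)) := (hgs.fderiv_apply_single hW hd i).mono hΔW hΔ
  have hDc : ContinuousOn (fun z => fderiv ℝ g z (Pi.single i 1)) (soloInformedSimplex (m + 1)) :=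
    ((hgd.continuousOn_fderiv_of_isOpen hW le_rfl).clm_apply continuousOn_const).mono hΔW
  -- the coordinate permutation
  have hPs := soloInformed_isSemialgebraicMapOn_facePerm i hΔ
  have hPm : MapsTo (soloInformedFacePerm i) (soloInformedSimplex (m + 1))
      (soloInformedSimplex (m + 1)) := fun z hz => soloInformedFacePerm_mem i hz
  have hPc : Continuous (soloInformedFacePerm i) := (soloInformedFacePermCLM i).continuous
  -- facet integrands
  have hTs : IsSemialgebraicFunOn ℚ (soloInformedSimplex m) (fun s => g (soloInformedTopFace i s)) :=
    IsSemialgebraicFunOn.comp_isSemialgebraicMapOn_holds hgsΔ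
      (soloInformed_isSemialgebraicMapOn_topFace hΔ' i) fun s hs => soloInformedTopFace_mem i hs
  have hTc : ContinuousOn (fun s => g (soloInformedTopFace i s)) (soloInformedSimplex m) :=
    hc.comp (soloInformed_continuous_topFace i).continuousOn
      fun s hs => hΔW (soloInformedTopFace_mem i hs)
  have hBs : IsSemialgebraicFunOn ℚ (soloInformedSimplex m)
      (fun s => g (soloInformedCoordFace i s)) :=
    IsSemialgebraicFunOn.comp_isSemialgebraicMapOn_holds hgsΔ
      (soloInformed_isSemialgebraicMapOn_coordFace hΔ' i) fun s hs => soloInformedCoordFace_mem i hs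
  have hBc : ContinuousOn (fun s => g (soloInformedCoordFace i s)) (soloInformedSimplex m) :=
    hc.comp (soloInformed_continuous_coordFace i).continuousOn
      fun s hs => hΔW (soloInformedCoordFace_mem i hs)
  have hfib : ∀ s ∈ soloInformedSimplex m, ∀ t ∈ Icc (0 : ℝ) (1 - ∑ k, s k),
      (Fin.insertNth i t s : Fin (m + 1) → ℝ) ∈ soloInformedSimplex (m + 1) :=
    fun s hs t ht => soloInformed_insertNth_mem_simplex i hs ht.1 ht.2
  -- (1) relabel: `A_P = [Δ, (∂ᵢ g) ∘ Pᵢ]`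
  let AP : IntegralRep (m + 1) := soloInformedSimplexRep (m + 1)
    (fun z => fderiv ℝ g (soloInformedFacePerm i z) (Pi.single i 1))
    (IsSemialgebraicFunOn.comp_isSemialgebraicMapOn_holds hDs hPs hPm)
    (hDc.comp hPc.continuousOn hPm)
  have h1 : of AP - of rD ∈ relations :=
    soloInformed_of_sub_of_affine_mem_relations (soloInformedFacePermCLM i) 0 (fun z => by simp)
      hPs (soloInformedFacePerm_injective i).injOn (soloInformedFacePerm_image i) AP rD rfl hDd
      fun z hz => by
        show fderiv ℝ g (soloInformedFacePerm i z) (Pi.single i 1) =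
          rD.integrand (soloInformedFacePerm i z)
        rw [hDi (soloInformedFacePerm_mem i hz)]
  -- (2) Newton–Leibniz along the band
  let Base : IntegralRep m := soloInformedSimplexRep m
    (fun s => g (soloInformedTopFace i s) - g (soloInformedCoordFace i s))
    (IsSemialgebraicFunOn.sub_holds hTs hBs) (hTc.sub hBc)
  have h2 : of AP - of Base ∈ relations := by
    refine newtonLeibnizRel_subset_relations ⟨m, AP, Base, fun _ => 0, fun s => 1 - ∑ k, s k,
      fun z => g (soloInformedFacePerm i z), ?_, ?_, ?_, ?_, soloInformedSimplex_succ_eq_band m,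
      ?_, ?_, ?_, rfl⟩
    · exact IsSemialgebraicFunOn.comp_isSemialgebraicMapOn_holds hgsΔ hPs hPm
    · exact (by simpa using isSemialgebraicFunOn_ratCast hΔ' 0 :
        IsSemialgebraicFunOn ℚ (soloInformedSimplex m) fun _ : Fin m → ℝ => (0 : ℝ))
    · exact soloInformed_isSemialgebraicFunOn_one_sub_sum hΔ'
    · exact fun s hs => soloInformed_sub_sum_nonneg hs
    · intro s hs
      have hs' : s ∈ soloInformedSimplex m := hs
      show ContinuousOn (fun t : ℝ => g (soloInformedFacePerm i (Fin.snoc s t)))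
        (Icc 0 (1 - ∑ k, s k))
      simp only [soloInformedFacePerm_snoc]
      exact hc.comp (soloInformed_continuous_insertNth i s).continuousOn
        fun t ht => hΔW (hfib s hs' t ht)
    · intro s hs t ht
      have hs' : s ∈ soloInformedSimplex m := hs
      have ht' : t ∈ Ioo (0 : ℝ) (1 - ∑ k, s k) := ht
      have hzW : (Fin.insertNth i t s : Fin (m + 1) → ℝ) ∈ W :=
        hΔW (hfib s hs' t (Ioo_subset_Icc_self ht'))
      show HasDerivAt (fun u : ℝ => g (soloInformedFacePerm i (Fin.snoc s u)))
        (fderiv ℝ g (soloInformedFacePerm i (Fin.snoc s t)) (Pi.single i 1)) t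
      simp only [soloInformedFacePerm_snoc]
      exact (hd _ hzW).hasFDerivAt.comp_hasDerivAt t (soloInformed_hasDerivAt_insertNth i s t)
    · intro s _
      show g (soloInformedTopFace i s) - g (soloInformedCoordFace i s) =
        g (soloInformedFacePerm i (Fin.snoc s (1 - ∑ k, s k))) -
          g (soloInformedFacePerm i (Fin.snoc s 0))
      rw [soloInformedFacePerm_snoc, soloInformedFacePerm_snoc]
      rfl
  -- (3) split the base integrand
  let N : IntegralRep m :=
    soloInformedSimplexRep m (fun s => -g (soloInformedCoordFace i s)) hBs.neg hBc.neg
  have h3 : of Base - of rT - of N ∈ relations :=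
    integrandAddRel_subset_relations ⟨m, Base, rT, N, by rw [hTd]; rfl, rfl, fun s hs => by
      have hs' : s ∈ soloInformedSimplex m := hs
      show g (soloInformedTopFace i s) - g (soloInformedCoordFace i s) =
        rT.integrand s + -g (soloInformedCoordFace i s)
      rw [hTi hs']
      ring, rfl⟩
  have h4 : of N + of rB ∈ relations :=
    of_add_of_mem_relations_of_eqOn_neg (r := N) (r' := rB) (by rw [hBd]; rfl) fun s hs => by
      have hs' : s ∈ soloInformedSimplex m := hs
      rw [hBi hs']
      show g (soloInformedCoordFace i s) = -(-g (soloInformedCoordFace i s))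
      rw [neg_neg]
  have key : of rD - (of rT - of rB) =
      -(of AP - of rD) + (of AP - of Base) + (of Base - of rT - of N) + (of N + of rB) := by abel
  rw [key]
  exact relations.add_mem (relations.add_mem (relations.add_mem (relations.neg_mem h1) h2) h3) h4

/-- **The two parametrisations of a top facet agree up to a move.**  `[Δᵐ, g ∘ τᵢ] − [Δᵐ, g ∘ ∂⁰]
∈ KZ.relations`: the affine automorphism `Aᵢ` of `Δᵐ` (`soloInformedFaceMix i`, a relabelling of the
vertices) satisfies `∂⁰ ∘ Aᵢ = τᵢ` and has `|det| = 1`, so it is a change-of-variables move.  No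
hypothesis on `g` is needed beyond those carried by the two representations. -/
theorem soloInformed_kzStokes_topFace_obliqueFace {m : ℕ} {g : (Fin (m + 1) → ℝ) → ℝ}
    (i : Fin (m + 1)) (rT rO : IntegralRep m) (hTd : rT.domain = soloInformedSimplex m)
    (hOd : rO.domain = soloInformedSimplex m)
    (hTi : EqOn rT.integrand (fun s => g (soloInformedTopFace i s)) (soloInformedSimplex m))
    (hOi : EqOn rO.integrand (fun s => g (soloInformedObliqueFace s)) (soloInformedSimplex m)) :
    of rT - of rO ∈ relations :=
  soloInformed_of_sub_of_affine_mem_relations (soloInformedFaceMixCLM i) _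
    (soloInformedFaceMix_eq_affine i)
    (soloInformed_isSemialgebraicMapOn_faceMix i (isSemialgebraic_soloInformedSimplex m))
    (soloInformedFaceMix_injective i).injOn (soloInformedFaceMix_image i) rT rO hTd hOd
    fun s hs => by
      rw [hTi hs, hOi (soloInformedFaceMix_mem i hs)]
      exact congrArg g (soloInformedObliqueFace_faceMix i s).symm

/-! ### Stokes' formula on the simplex -/

/-- Signs `(−1)ˡ` are `±1`. -/
theorem soloInformed_neg_one_pow_eq_or (l : ℕ) : ((-1 : ℤ) ^ l) = 1 ∨ ((-1 : ℤ) ^ l) = -1 := by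
  rcases Nat.even_or_odd l with h | h
  · exact Or.inl h.neg_one_pow
  · exact Or.inr h.neg_one_pow

/-- **KZ–Stokes on the simplex, every dimension.**  For `g₀, …, g_m` semialgebraic over `ℚ` and `C¹`
on an open `W ⊇ Δᵐ⁺¹`, and any representations `rD = [Δᵐ⁺¹, Σᵢ (−1)ⁱ ∂ᵢ gᵢ]`,
`rF 0 = [Δᵐ, Σᵢ (−1)ⁱ gᵢ ∘ ∂⁰]` (oblique facet) and `rF (i+1) = [Δᵐ, gᵢ ∘ ∂ᶻᵢ]` (facet `zᵢ = 0`;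
only `gᵢ` survives there), the Stokes element `rD − Σₗ (−1)ˡ rF l` lies in `KZ.relations`: Stokes'
formula for the simplex is a `ℤ`-combination of integrand additivity, change of variables and the
one-variable Newton–Leibniz formula. -/
theorem soloInformed_kzStokes_simplex {m : ℕ} {W : Set (Fin (m + 1) → ℝ)} (hW : IsOpen W)
    (hΔW : soloInformedSimplex (m + 1) ⊆ W) {g : Fin (m + 1) → (Fin (m + 1) → ℝ) → ℝ}
    (hgs : ∀ i, IsSemialgebraicFunOn ℚ W (g i)) (hgd : ∀ i, ContDiffOn ℝ 1 (g i) W)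
    (rD : IntegralRep (m + 1)) (hDd : rD.domain = soloInformedSimplex (m + 1))
    (hDi : EqOn rD.integrand (fun z => ∑ i : Fin (m + 1), (-1 : ℝ) ^ (i : ℕ) * fderiv ℝ (g i) z (Pi.single i 1))
      (soloInformedSimplex (m + 1)))
    (rF : Fin (m + 2) → IntegralRep m) (hFd : ∀ l, (rF l).domain = soloInformedSimplex m)
    (hF0 : EqOn (rF 0).integrand (fun s => ∑ i : Fin (m + 1), (-1 : ℝ) ^ (i : ℕ) * g i (soloInformedObliqueFace s))
      (soloInformedSimplex m))
    (hFs : ∀ i : Fin (m + 1), EqOn (rF i.succ).integrand (fun s => g i (soloInformedCoordFace i s))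
      (soloInformedSimplex m)) :
    of rD - ∑ l : Fin (m + 2), ((-1 : ℤ) ^ (l : ℕ)) • of (rF l) ∈ relations := by
  have hΔ := isSemialgebraic_soloInformedSimplex (m + 1)
  have hΔ' := isSemialgebraic_soloInformedSimplex m
  have hd : ∀ i, ∀ z ∈ W, DifferentiableAt ℝ (g i) z := fun i z hz =>
    ((hgd i).differentiableOn one_ne_zero z hz).differentiableAt (hW.mem_nhds hz)
  have hDs : ∀ i, IsSemialgebraicFunOn ℚ (soloInformedSimplex (m + 1))
      (fun z => fderiv ℝ (g i) z (Pi.single i 1)) :=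
    fun i => ((hgs i).fderiv_apply_single hW (hd i) i).mono hΔW hΔ
  have hDc : ∀ i, ContinuousOn (fun z => fderiv ℝ (g i) z (Pi.single i 1))
      (soloInformedSimplex (m + 1)) :=
    fun i => (((hgd i).continuousOn_fderiv_of_isOpen hW le_rfl).clm_apply continuousOn_const).mono hΔW
  have hTs : ∀ i, IsSemialgebraicFunOn ℚ (soloInformedSimplex m)
      (fun s => g i (soloInformedTopFace i s)) :=
    fun i => IsSemialgebraicFunOn.comp_isSemialgebraicMapOn_holds ((hgs i).mono hΔW hΔ)
      (soloInformed_isSemialgebraicMapOn_topFace hΔ' i) fun s hs => soloInformedTopFace_mem i hs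
  have hTc : ∀ i, ContinuousOn (fun s => g i (soloInformedTopFace i s)) (soloInformedSimplex m) :=
    fun i => (hgd i).continuousOn.comp (soloInformed_continuous_topFace i).continuousOn
      fun s hs => hΔW (soloInformedTopFace_mem i hs)
  have hOs : ∀ i, IsSemialgebraicFunOn ℚ (soloInformedSimplex m)
      (fun s => g i (soloInformedObliqueFace s)) :=
    fun i => IsSemialgebraicFunOn.comp_isSemialgebraicMapOn_holds ((hgs i).mono hΔW hΔ)
      (soloInformed_isSemialgebraicMapOn_obliqueFace hΔ') fun s hs => soloInformedObliqueFace_mem hs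
  have hOc : ∀ i, ContinuousOn (fun s => g i (soloInformedObliqueFace s)) (soloInformedSimplex m) :=
    fun i => (hgd i).continuousOn.comp soloInformed_continuous_obliqueFace.continuousOn
      fun s hs => hΔW (soloInformedObliqueFace_mem hs)
  let D : Fin (m + 1) → IntegralRep (m + 1) := fun i => soloInformedSimplexRep (m + 1) _ (hDs i) (hDc i)
  let T : Fin (m + 1) → IntegralRep m := fun i => soloInformedSimplexRep m _ (hTs i) (hTc i)
  let O : Fin (m + 1) → IntegralRep m := fun i => soloInformedSimplexRep m _ (hOs i) (hOc i)
  have hε : ∀ i : Fin (m + 1), ((-1 : ℤ) ^ (i : ℕ)) = 1 ∨ ((-1 : ℤ) ^ (i : ℕ)) = -1 :=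
    fun i => soloInformed_neg_one_pow_eq_or i
  have hX : of rD - ∑ i : Fin (m + 1), ((-1 : ℤ) ^ (i : ℕ)) • of (D i) ∈ relations :=
    soloInformed_of_sub_signedSum_mem_relations rD D _ hε (fun i => by rw [hDd]; rfl) fun z hz => by
      have hz' : z ∈ soloInformedSimplex (m + 1) := by rw [← hDd]; exact hz
      rw [hDi hz']
      simp [D]
  have hY : of (rF 0) - ∑ i : Fin (m + 1), ((-1 : ℤ) ^ (i : ℕ)) • of (O i) ∈ relations :=
    soloInformed_of_sub_signedSum_mem_relations (rF 0) O _ hε (fun i => by rw [hFd]; rfl)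
      fun s hs => by
        have hs' : s ∈ soloInformedSimplex m := by rw [← hFd 0]; exact hs
        rw [hF0 hs']
        simp [O]
  have he : ∀ i : Fin (m + 1), of (D i) - of (O i) + of (rF i.succ) ∈ relations := fun i => by
    have h1 := soloInformed_kzStokes_face hW hΔW (hgs i) (hgd i) i (D i) rfl (fun _ _ => rfl) (T i)
      (rF i.succ) rfl (hFd _) (fun _ _ => rfl) (hFs i)
    have h2 := soloInformed_kzStokes_topFace_obliqueFace (g := g i) i (T i) (O i) rfl rfl
      (fun _ _ => rfl) (fun _ _ => rfl)
    have key : of (D i) - of (O i) + of (rF i.succ) =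
        (of (D i) - (of (T i) - of (rF i.succ))) + (of (T i) - of (O i)) := by abel
    rw [key]
    exact relations.add_mem h1 h2
  have hS : ∑ i : Fin (m + 1), ((-1 : ℤ) ^ (i : ℕ)) • (of (D i) - of (O i) + of (rF i.succ)) ∈
      relations := sum_mem fun i _ => relations.zsmul_mem (he i) _
  have key : of rD - ∑ l : Fin (m + 2), ((-1 : ℤ) ^ (l : ℕ)) • of (rF l) =
      (of rD - ∑ i : Fin (m + 1), ((-1 : ℤ) ^ (i : ℕ)) • of (D i)) -
        (of (rF 0) - ∑ i : Fin (m + 1), ((-1 : ℤ) ^ (i : ℕ)) • of (O i)) +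
        ∑ i : Fin (m + 1), ((-1 : ℤ) ^ (i : ℕ)) • (of (D i) - of (O i) + of (rF i.succ)) := by
    rw [Fin.sum_univ_succ]
    simp only [Fin.val_zero, pow_zero, one_smul, Fin.val_succ, pow_succ, mul_neg, mul_one, neg_smul,
      smul_add, smul_sub, Finset.sum_add_distrib, Finset.sum_sub_distrib, Finset.sum_neg_distrib]
    abel
  rw [key]
  exact relations.add_mem (relations.sub_mem hX hY) hS

/-- **Stokes' formula on the simplex, as numbers**: `∫_Δ Σᵢ (−1)ⁱ ∂ᵢ gᵢ = Σₗ (−1)ˡ ∫_{Δᵐ} (rF l)`,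
from `soloInformed_kzStokes_simplex` and the soundness of the calculus
(`KZ.relations_le_ker_eval_holds`) — i.e. from one-variable calculus and linear algebra only. -/
theorem soloInformed_stokes_simplex_value {m : ℕ} {W : Set (Fin (m + 1) → ℝ)} (hW : IsOpen W)
    (hΔW : soloInformedSimplex (m + 1) ⊆ W) {g : Fin (m + 1) → (Fin (m + 1) → ℝ) → ℝ}
    (hgs : ∀ i, IsSemialgebraicFunOn ℚ W (g i)) (hgd : ∀ i, ContDiffOn ℝ 1 (g i) W)
    (rD : IntegralRep (m + 1)) (hDd : rD.domain = soloInformedSimplex (m + 1))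
    (hDi : EqOn rD.integrand (fun z => ∑ i : Fin (m + 1), (-1 : ℝ) ^ (i : ℕ) * fderiv ℝ (g i) z (Pi.single i 1))
      (soloInformedSimplex (m + 1)))
    (rF : Fin (m + 2) → IntegralRep m) (hFd : ∀ l, (rF l).domain = soloInformedSimplex m)
    (hF0 : EqOn (rF 0).integrand (fun s => ∑ i : Fin (m + 1), (-1 : ℝ) ^ (i : ℕ) * g i (soloInformedObliqueFace s))
      (soloInformedSimplex m))
    (hFs : ∀ i : Fin (m + 1), EqOn (rF i.succ).integrand (fun s => g i (soloInformedCoordFace i s))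
      (soloInformedSimplex m)) :
    rD.value = ∑ l : Fin (m + 2), (-1 : ℝ) ^ (l : ℕ) * (rF l).value := by
  have h := relations_le_ker_eval_holds
    (soloInformed_kzStokes_simplex hW hΔW hgs hgd rD hDd hDi rF hFd hF0 hFs)
  rw [AddMonoidHom.mem_ker, map_sub, map_sum, eval_of, sub_eq_zero] at h
  rw [h]
  refine Finset.sum_congr rfl fun l _ => ?_
  rw [map_zsmul, eval_of, zsmul_eq_mul]
  push_cast
  ring

/-- **Existence of the representations**, so that `soloInformed_kzStokes_simplex` is not vacuous. -/
theorem soloInformed_kzStokes_simplex_exists {m : ℕ} {W : Set (Fin (m + 1) → ℝ)} (hW : IsOpen W)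
    (hΔW : soloInformedSimplex (m + 1) ⊆ W) {g : Fin (m + 1) → (Fin (m + 1) → ℝ) → ℝ}
    (hgs : ∀ i, IsSemialgebraicFunOn ℚ W (g i)) (hgd : ∀ i, ContDiffOn ℝ 1 (g i) W) :
    ∃ (rD : IntegralRep (m + 1)) (rF : Fin (m + 2) → IntegralRep m),
      rD.domain = soloInformedSimplex (m + 1) ∧
      (rD.integrand = fun z => ∑ i : Fin (m + 1), (-1 : ℝ) ^ (i : ℕ) * fderiv ℝ (g i) z (Pi.single i 1)) ∧
      (∀ l, (rF l).domain = soloInformedSimplex m) ∧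
      ((rF 0).integrand = fun s => ∑ i : Fin (m + 1), (-1 : ℝ) ^ (i : ℕ) * g i (soloInformedObliqueFace s)) ∧
      (∀ i : Fin (m + 1), (rF i.succ).integrand = fun s => g i (soloInformedCoordFace i s)) ∧
      of rD - ∑ l : Fin (m + 2), ((-1 : ℤ) ^ (l : ℕ)) • of (rF l) ∈ relations := by
  have hΔ := isSemialgebraic_soloInformedSimplex (m + 1)
  have hΔ' := isSemialgebraic_soloInformedSimplex m
  have hd : ∀ i, ∀ z ∈ W, DifferentiableAt ℝ (g i) z := fun i z hz =>
    ((hgd i).differentiableOn one_ne_zero z hz).differentiableAt (hW.mem_nhds hz)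
  have hσ : ∀ i : Fin (m + 1), IsSemialgebraicFunOn ℚ (soloInformedSimplex (m + 1))
      (fun _ => (-1 : ℝ) ^ (i : ℕ)) :=
    fun i => by simpa using isSemialgebraicFunOn_ratCast hΔ ((-1) ^ (i : ℕ))
  have hσ' : ∀ i : Fin (m + 1), IsSemialgebraicFunOn ℚ (soloInformedSimplex m)
      (fun _ => (-1 : ℝ) ^ (i : ℕ)) :=
    fun i => by simpa using isSemialgebraicFunOn_ratCast hΔ' ((-1) ^ (i : ℕ))
  have hDs : IsSemialgebraicFunOn ℚ (soloInformedSimplex (m + 1))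
      (fun z => ∑ i : Fin (m + 1), (-1 : ℝ) ^ (i : ℕ) * fderiv ℝ (g i) z (Pi.single i 1)) :=
    soloInformed_isSemialgebraicFunOn_sum hΔ
      (fun i z => (-1 : ℝ) ^ (i : ℕ) * fderiv ℝ (g i) z (Pi.single i 1)) fun i =>
      IsSemialgebraicFunOn.mul_holds (hσ i) (((hgs i).fderiv_apply_single hW (hd i) i).mono hΔW hΔ)
  have hDc : ContinuousOn (fun z => ∑ i : Fin (m + 1), (-1 : ℝ) ^ (i : ℕ) * fderiv ℝ (g i) z (Pi.single i 1))
      (soloInformedSimplex (m + 1)) :=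
    continuousOn_finsetSum _ fun i _ => continuousOn_const.mul
      ((((hgd i).continuousOn_fderiv_of_isOpen hW le_rfl).clm_apply continuousOn_const).mono hΔW)
  have hOs : IsSemialgebraicFunOn ℚ (soloInformedSimplex m)
      (fun s => ∑ i : Fin (m + 1), (-1 : ℝ) ^ (i : ℕ) * g i (soloInformedObliqueFace s)) :=
    soloInformed_isSemialgebraicFunOn_sum hΔ'
      (fun i s => (-1 : ℝ) ^ (i : ℕ) * g i (soloInformedObliqueFace s)) fun i =>
      IsSemialgebraicFunOn.mul_holds (hσ' i)
        (IsSemialgebraicFunOn.comp_isSemialgebraicMapOn_holds ((hgs i).mono hΔW hΔ)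
          (soloInformed_isSemialgebraicMapOn_obliqueFace hΔ') fun s hs => soloInformedObliqueFace_mem hs)
  have hOc : ContinuousOn (fun s => ∑ i : Fin (m + 1), (-1 : ℝ) ^ (i : ℕ) * g i (soloInformedObliqueFace s))
      (soloInformedSimplex m) :=
    continuousOn_finsetSum _ fun i _ => continuousOn_const.mul
      ((hgd i).continuousOn.comp soloInformed_continuous_obliqueFace.continuousOn
        fun s hs => hΔW (soloInformedObliqueFace_mem hs))
  have hBs : ∀ i, IsSemialgebraicFunOn ℚ (soloInformedSimplex m)
      (fun s => g i (soloInformedCoordFace i s)) :=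
    fun i => IsSemialgebraicFunOn.comp_isSemialgebraicMapOn_holds ((hgs i).mono hΔW hΔ)
      (soloInformed_isSemialgebraicMapOn_coordFace hΔ' i) fun s hs => soloInformedCoordFace_mem i hs
  have hBc : ∀ i, ContinuousOn (fun s => g i (soloInformedCoordFace i s)) (soloInformedSimplex m) :=
    fun i => (hgd i).continuousOn.comp (soloInformed_continuous_coordFace i).continuousOn
      fun s hs => hΔW (soloInformedCoordFace_mem i hs)
  refine ⟨soloInformedSimplexRep (m + 1) _ hDs hDc,
    Fin.cons (soloInformedSimplexRep m _ hOs hOc) fun i => soloInformedSimplexRep m _ (hBs i) (hBc i),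
    rfl, rfl, fun l => Fin.cases (by simp) (fun i => by simp) l, by simp, fun i => by simp, ?_⟩
  exact soloInformed_kzStokes_simplex hW hΔW hgs hgd _ rfl (fun _ _ => rfl) _
    (fun l => Fin.cases (by simp) (fun i => by simp) l) (fun _ _ => by simp) fun i _ _ => by simp

end Summit.KontsevichZagierPeriods.KontsevichZagierPeriods.Theorems
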